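import Mathlib
import Summits.CriticalPhenomena.CardyFormulaZ2.Theses.CardyFlipRusso
import Summits.CriticalPhenomena.CardyFormulaZ2.Theorems.CardyFlipRussoSquareFromVoronoiHubDefs
import Summits.CriticalPhenomena.CardyFormulaZ2.Theorems.CardyFlipRussoSquareFromVoronoiHubSmallCells
import Summits.CriticalPhenomena.CardyFormulaZ2.Theorems.CardyFlipRussoSquareFromVoronoiHubFaithfulDefs
import Summits.CriticalPhenomena.CardyFormulaZ2.Theorems.CardyFlipRussoSquareFromVoronoiHubFaithfulPart3b
import Summits.CriticalPhenomena.CardyFormulaZ2.Theorems.CardyFlipRussoSquareFromVoronoiHubPerturbedRectangles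
import Summits.CriticalPhenomena.CardyFormulaZ2.Theorems.CardyFlipRussoSquareFromVoronoiHubNoDefect
import Summits.CriticalPhenomena.CardyFormulaZ2.Theorems.CardyFlipRussoSquareFromVoronoiHubFatTube
import Summits.CriticalPhenomena.CardyFormulaZ2.Theorems.CardyFlipRussoSquareFromVoronoiHubSandwich
import Literature.Analysis.FunctionSpaces.PoissonPointProcessExistence
import Literature.Probability.RandomPlanarGeometry.ConformalRectangleProofs

/-!
# Line `Sketch` of crux `SquareFromVoronoiHub`: K1 assembled, and the crux ⟺ block-colouring invariance C⁺

Crux `Summit.CriticalPhenomena.CardyFormulaZ2.Theses.CardyFlipRusso.SquareFromVoronoiHub`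
(stmt-CriticalPhenomena-6434): Cardy's formula for annealed Poisson–Voronoi percolation
(continuum-path event, every conformal rectangle) ⇒ Cardy's formula for site percolation at `1/2` on
the centred square lattice `G_s` (crude `2δ`-slack event, every conformal rectangle).

Line `Sketch` (card `voronoi-blocks-on-fixed-gs`) reads the fair-coloured Poisson nuclei of cell
scale `s` off the fixed lattice `G_s(δ)` (`blockConfig`, `blockCrossingProb` of `…Defs.lean`).

§1 (namespace `…VoronoiBlocks.Faithful`) ASSEMBLES K1 from its landed pieces:
* `sandwich_eighth` — the black/dual-white SANDWICH at cell scale `ε = δ^{1/8}`: the four wave-2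
  theorems `stub_perturbedRectangles` (S1, Schoenflies-box perturbed conformal rectangles with the
  metric cap/collar clauses and the topological crossing clause; `…PerturbedRectangles.lean`),
  `stub_noDefect` (S2, the bulk no-defect event has probability `→ 1`, unweighted Poisson moments;
  `…NoDefect.lean`), `stub_fatTube` (strictly black fat tube shadowing a black continuum path;
  `…FatTube.lean`) fed into the S3+S4 assembly `stub_sandwich_of` (`…Sandwich.lean`);
* `stub_faithful_eighth` (registered sub-goal) — **K1**: under the crux's hypothesis, for every
  Poisson pair and conformal rectangle, `block(δ, δ^{1/8}) − vor(δ^{1/8}) → 0` as `δ → 0⁺`, by the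
  squeeze `faithful_of_dual_sandwich_eighth` (`…FaithfulPart3b.lean`).

§2 (namespace `…VoronoiBlocks`): with E (existence of the planar Poisson process,
`existsUnique_isPoissonPointProcess_holds`), K0 (`…SmallCells.lean` `stub_smallCells`: at `s = δ²`
the block colouring is site percolation up to `o(1)`) and K1, all PROVED, the crux is EQUIVALENT to
the block-colouring invariance C⁺ between the cell scales `δ²` and `δ^{1/8}` — both directions,
unconditionally, as registered sub-goals:
* `stub_crux_of_blockInvariance` — C⁺ ⇒ the crux (the four-term `Tendsto` chain
  `site(δ) = vor(δ^{1/8}) + [block(δ,δ^{1/8}) − vor] + [block(δ,δ²) − block(δ,δ^{1/8})] − [block(δ,δ²) − site(δ)] → F(η)`);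
* `stub_blockInvariance_of_crux` — the crux ⇒ C⁺ (the same chain read backwards).

So the crux's entire open content is C⁺: crossing universality along ONE explicit one-parameter
family of fair, positively associated, `Aut(G_s)`-invariant colourings of the fixed lattice `G_s`,
between i.i.d. site percolation (`s = δ²`) and lattice-read Poisson–Voronoi percolation
(`s = δ^{1/8}`).  One-line compositions of tree theorems; no new definition; standard axioms.

Sources: Bollobás–Riordan, *Percolation* (2006), Ch. 7 (19) with Lemma 14, Ch. 8 §8.3; Pommerenke
(1992) Cor. 2.9 (Schoenflies); Benjamini–Schramm, Comm. Math. Phys. 197 (1998) §1.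
-/

noncomputable section

/-! ## §1 K1 assembled -/

namespace Summit.CriticalPhenomena.CardyFormulaZ2.Cruxes.SquareFromVoronoiHub.VoronoiBlocks.Faithful

open scoped Topology Pointwise
open Set Filter MeasureTheory Metric
open UpperHalfPlane (upperHalfPlaneSet)
open Literature.Analysis.FunctionSpaces (PointConfig IsPoissonPointProcess)
open Literature.Probability.Percolation (SiteConfig blackRegion voronoiCrossing)
open Literature.Probability.RandomPlanarGeometry (ConformalRectangle ConformalEquiv cardyFunction
  crossRatio)

/-- **The sandwich at cell scale `δ^{1/8}`** (no hypothesis): for every Poisson pair, conformal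
rectangle `R` and `θ > 0`, perturbed conformal rectangles `R₁`, `R₂` with uniformizing data whose
Cardy values are within `θ` of `F(η_R)` resp. `1 − F(η_R)` such that, eventually as `δ → 0⁺`,
`vor_{R₁}(δ^{1/8}) − θ ≤ block_R(δ, δ^{1/8}) ≤ 1 − vor^{white}_{R₂}(δ^{1/8}) + θ`.  Composition of the
four landed wave-2 theorems. [cite: BollobasRiordan2006, Ch. 7 Lemma 14 with (19)] -/
theorem sandwich_eighth : ∀ (PB PW : Measure (PointConfig ℂ)),
    IsPoissonPointProcess (volume : Measure ℂ) PB → IsPoissonPointProcess (volume : Measure ℂ) PW →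
    ∀ (R : ConformalRectangle) (θ : ℝ), 0 < θ → ∃ (R₁ R₂ : ConformalRectangle)
      (φ₁ : ConformalEquiv upperHalfPlaneSet R₁.carrier) (x₁ : Fin 4 → ℝ)
      (φ₂ : ConformalEquiv upperHalfPlaneSet R₂.carrier) (x₂ : Fin 4 → ℝ),
      R₁.IsUniformizing φ₁ x₁ ∧ R₂.IsUniformizing φ₂ x₂ ∧
      (∀ (φ : ConformalEquiv upperHalfPlaneSet R.carrier) (x : Fin 4 → ℝ), R.IsUniformizing φ x →
        |cardyFunction (crossRatio x₁) - cardyFunction (crossRatio x)| ≤ θ ∧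
        |(1 - cardyFunction (crossRatio x₂)) - cardyFunction (crossRatio x)| ≤ θ) ∧
      ∀ᶠ δ in 𝓝[>] (0 : ℝ),
        voronoiCrossingProb PB PW R₁ (δ ^ (1 / 8 : ℝ)) - θ ≤
            blockCrossingProb PB PW R δ (δ ^ (1 / 8 : ℝ)) ∧
          blockCrossingProb PB PW R δ (δ ^ (1 / 8 : ℝ)) ≤
            1 - voronoiCrossingProb PW PB R₂ (δ ^ (1 / 8 : ℝ)) + θ :=
  stub_sandwich_of stub_perturbedRectangles stub_noDefect stub_fatTube

/-- **K1 — registered sub-goal `stub_faithful_eighth`** of crux stmt-CriticalPhenomena-6434: under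
Cardy's formula for annealed Poisson–Voronoi percolation (all Poisson pairs of Lebesgue intensity,
all conformal rectangles), the crude `G_s(δ)` block crossing probability at cell scale `δ^{1/8}` and
the continuum Voronoi crossing probability at mesh `δ^{1/8}` differ by `o(1)` as `δ → 0⁺`, for
every Poisson pair and every conformal rectangle.  The sandwich `sandwich_eighth` squeezed against
the hypothesis on `R`, `R₁`, `R₂` (`faithful_of_dual_sandwich_eighth`).
[cite: BollobasRiordan2006, Ch. 7 Lemma 14 with (19); Ch. 8 §8.3] -/
theorem stub_faithful_eighth :
    (∀ (PB PW : Measure (PointConfig ℂ)),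
      IsPoissonPointProcess (volume : Measure ℂ) PB → IsPoissonPointProcess (volume : Measure ℂ) PW →
      ∀ R : ConformalRectangle, R.HasCrossingLimit (voronoiCrossingProb PB PW R) cardyFunction) →
    ∀ (PB PW : Measure (PointConfig ℂ)),
      IsPoissonPointProcess (volume : Measure ℂ) PB → IsPoissonPointProcess (volume : Measure ℂ) PW →
      ∀ R : ConformalRectangle,
        Tendsto (fun δ : ℝ => blockCrossingProb PB PW R δ (δ ^ (1 / 8 : ℝ)) -
            voronoiCrossingProb PB PW R (δ ^ (1 / 8 : ℝ))) (𝓝[>] 0) (𝓝 0) :=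
  faithful_of_dual_sandwich_eighth sandwich_eighth

end Summit.CriticalPhenomena.CardyFormulaZ2.Cruxes.SquareFromVoronoiHub.VoronoiBlocks.Faithful

/-! ## §2 The crux ⟺ C⁺ -/

namespace Summit.CriticalPhenomena.CardyFormulaZ2.Cruxes.SquareFromVoronoiHub.VoronoiBlocks

open scoped Topology
open Set Filter MeasureTheory
open Literature.Analysis.FunctionSpaces (PointConfig IsPoissonPointProcess)
open Literature.Probability.RandomPlanarGeometry (ConformalRectangle cardyFunction crossRatio)

/-- **C⁺ ⇒ the crux** (registered sub-goal `stub_crux_of_blockInvariance` of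
stmt-CriticalPhenomena-6434): if, under Cardy's formula for annealed Poisson–Voronoi percolation,
the crude `G_s(δ)` crossing probabilities of the block colourings at cell scales `δ²` and `δ^{1/8}`
differ by `o(1)` for every Poisson pair and every conformal rectangle, then the crux
`SquareFromVoronoiHub` holds.  Proof: E (a Poisson law `P`, used for both colours), K0, C⁺, K1 and
the hypothesis at mesh `δ^{1/8}` sum to `site(δ) → F(η)`. [folklore] -/
theorem stub_crux_of_blockInvariance :
    ((∀ (PB PW : Measure (PointConfig ℂ)),
        IsPoissonPointProcess (volume : Measure ℂ) PB → IsPoissonPointProcess (volume : Measure ℂ) PW →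
        ∀ R : ConformalRectangle, R.HasCrossingLimit (voronoiCrossingProb PB PW R) cardyFunction) →
      ∀ (PB PW : Measure (PointConfig ℂ)),
        IsPoissonPointProcess (volume : Measure ℂ) PB → IsPoissonPointProcess (volume : Measure ℂ) PW →
        ∀ R : ConformalRectangle,
          Tendsto (fun δ : ℝ => blockCrossingProb PB PW R δ (δ ^ 2) -
              blockCrossingProb PB PW R δ (δ ^ (1 / 8 : ℝ))) (𝓝[>] 0) (𝓝 0)) →
    Summit.CriticalPhenomena.CardyFormulaZ2.Theses.CardyFlipRusso.SquareFromVoronoiHub := by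
  intro hC
  refine squareFromVoronoiHub_iff.mpr ?_
  intro hV R φ x hux
  obtain ⟨P, hP, -⟩ :=
    Literature.Analysis.FunctionSpaces.existsUnique_isPoissonPointProcess_holds (E := ℂ)
      (volume : Measure ℂ) (fun z => measure_singleton z)
  have ha : (0 : ℝ) < 1 / 8 := by norm_num
  have hA : Tendsto (fun δ : ℝ => voronoiCrossingProb P P R (δ ^ (1 / 8 : ℝ))) (𝓝[>] 0)
      (𝓝 (cardyFunction (crossRatio x))) :=
    (hV P P hP hP R φ x hux).comp (Faithful.tendsto_rpow_nhdsGT_of_pos ha)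
  have hB := Faithful.stub_faithful_eighth hV P P hP hP R
  have hC' := hC hV P P hP hP R
  have hD := stub_smallCells P P hP hP R
  have hsum := ((hA.add hB).add hC').sub hD
  simp only [add_zero, sub_zero] at hsum
  refine hsum.congr fun δ => ?_
  ring

/-- **The crux ⇒ C⁺** (registered sub-goal `stub_blockInvariance_of_crux` of
stmt-CriticalPhenomena-6434): conversely, the crux gives `site(δ) → F(η)` under the hypothesis, and
K0, K1 and the hypothesis at mesh `δ^{1/8}` turn this into the block-colouring invariance between
the cell scales `δ²` and `δ^{1/8}`.  With `stub_crux_of_blockInvariance`: the crux is EQUIVALENT to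
C⁺. [folklore] -/
theorem stub_blockInvariance_of_crux :
    Summit.CriticalPhenomena.CardyFormulaZ2.Theses.CardyFlipRusso.SquareFromVoronoiHub →
    (∀ (PB PW : Measure (PointConfig ℂ)),
        IsPoissonPointProcess (volume : Measure ℂ) PB → IsPoissonPointProcess (volume : Measure ℂ) PW →
        ∀ R : ConformalRectangle, R.HasCrossingLimit (voronoiCrossingProb PB PW R) cardyFunction) →
      ∀ (PB PW : Measure (PointConfig ℂ)),
        IsPoissonPointProcess (volume : Measure ℂ) PB → IsPoissonPointProcess (volume : Measure ℂ) PW →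
        ∀ R : ConformalRectangle,
          Tendsto (fun δ : ℝ => blockCrossingProb PB PW R δ (δ ^ 2) -
              blockCrossingProb PB PW R δ (δ ^ (1 / 8 : ℝ))) (𝓝[>] 0) (𝓝 0) := by
  intro hcrux hV PB PW hPB hPW R
  obtain ⟨φ, x, hx⟩ :=
    (Literature.Probability.RandomPlanarGeometry.MarkedDomain.exists_isUniformizing_holds (n := 4)) R
  have ha : (0 : ℝ) < 1 / 8 := by norm_num
  have hS : Tendsto (siteCrossingProb R) (𝓝[>] 0) (𝓝 (cardyFunction (crossRatio x))) :=
    squareFromVoronoiHub_iff.mp hcrux hV R φ x hx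
  have hA : Tendsto (fun δ : ℝ => voronoiCrossingProb PB PW R (δ ^ (1 / 8 : ℝ))) (𝓝[>] 0)
      (𝓝 (cardyFunction (crossRatio x))) :=
    (hV PB PW hPB hPW R φ x hx).comp (Faithful.tendsto_rpow_nhdsGT_of_pos ha)
  have hB := Faithful.stub_faithful_eighth hV PB PW hPB hPW R
  have hD := stub_smallCells PB PW hPB hPW R
  have hsum := ((hD.add hS).sub hB).sub hA
  simp only [zero_add, sub_zero, sub_self] at hsum
  refine hsum.congr fun δ => ?_
  ring

end Summit.CriticalPhenomena.CardyFormulaZ2.Cruxes.SquareFromVoronoiHub.VoronoiBlocks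

end
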